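import Summits.RiemannHypothesis.RiemannHypothesis.Theses.EvenThetaVisibilityPinning
import HarnessLib

/-!
# Route `EvenThetaVisibilityPinning`, item `Assembly` (stmt-RiemannHypothesis-19850) — closed

`EvenThetaVisibility → ThetaWindowImage → EvenPinning → RH` is the route's own deciding theorem
`EvenThetaVisibilityPinning.closes`.  With `ThetaWindowImage` (stmt-19848, `thetaWindowImage_proof`)
and `EvenPinning` (stmt-19849, `evenPinning_routeForm`) proved from the GroundBarta theta-vector /
even-sector toolkit, the route reduces to its single RH-bearing crux `EvenThetaVisibility`.
-/

set_option linter.dupNamespace false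

namespace Summit.RiemannHypothesis.RiemannHypothesis.Theorems.EvenThetaVisibilityPinning

/-- **Item `Assembly` (stmt-RiemannHypothesis-19850)**: the three items imply RH (the route's
`closes`). [folklore] -/
theorem assembly_proof :
    Summit.RiemannHypothesis.RiemannHypothesis.Theses.EvenThetaVisibilityPinning.Assembly :=
  fun h1 h2 h3 => Summit.RiemannHypothesis.RiemannHypothesis.Theses.EvenThetaVisibilityPinning.closes h1 h2 h3

end Summit.RiemannHypothesis.RiemannHypothesis.Theorems.EvenThetaVisibilityPinning
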